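import Mathlib
import HarnessLib
import Literature.Probability.RandomPlanarGeometry.WeaklySAW
import Summits.CriticalPhenomena.SAWScalingLimit.Statement
import Summits.CriticalPhenomena.SAWScalingLimit.Theses.SAWEdwardsStrongCoupling

/-!
# Line `birth` — registered skeleton for the crux `SAWEdwardsStrongCoupling.CouplingUniversality`

Crux item stmt-CriticalPhenomena-4651 (rank 4 of `route-CriticalPhenomena-SAWEdwardsStrongCoupling`,
sub-problem `CriticalPhenomena/SAWScalingLimit`).  Skeleton registrar
`planner-skel-stmt-CriticalPhenomena-4651-0`, 2026-08-17 (BC3 birth certificate).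

## The crux (FIXED; concluded BY NAME by `CouplingUniversality_of`)

For every Dobrushin domain `(D; a, b)`, endpoint approximation `(a_δ, b_δ)` and two coupling
schedules `l₁ l₂ : ℝ → ℝ` with, eventually along `δ → 0⁺`, `lᵢ δ ∈ (0, 1]` and `lᵢ δ / δ² → ∞`
(diverging effective continuum coupling: fixed `λ`, `λ ≡ 1` = the SAW, and slowly closing Edwards
windows alike), the critical weakly self-avoiding (Domb–Joyce) chordal laws `WL_{l₁ δ}`, `WL_{l₂ δ}`
of `(Ω_δ; a_δ, b_δ)` are asymptotically equal in law: `∫ f dWL_{l₁ δ} - ∫ f dWL_{l₂ δ} → 0` for every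
bounded continuous `f` on `CurveClass ℂ`.  The item's inlined law `WL lam Ω δ a b` is, by `rfl`
(`WeaklySAW.domainLaw_def`; certified here by `couplingUniversality_iff := Iff.rfl`), the named law
`Literature.Probability.RandomPlanarGeometry.WeaklySAW.domainLaw lam Ω δ a b`
(`Literature/Probability/RandomPlanarGeometry/WeaklySAW.lean`, the definition request of this
route); the stubs are stated over it.

## The line: REGIME SPLIT of the coupling axis `(0, 1]` by the limit point of the coupling along a
mesh sequence (the route header's foreseen glued split "CouplingUniversality ⇐ FixedLambdaUniversality
→ ScheduleComparison", made exact)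

Write `Φ_δ(λ) := ∫ f dWL_λ(Ω_δ; a_δ, b_δ)`.  Along the countably generated filter `𝓝[>] 0` a real
function tends to `0` iff every mesh sequence `δₙ → 0⁺` has a subsequence along which it does
(`Filter.tendsto_of_subseq_tendsto`); along a subsequence the couplings `l(δₙ) ∈ (0, 1]` converge to
some `c⋆ ∈ [0, 1]` (Bolzano–Weierstrass), and the two cases `c⋆ > 0` / `c⋆ = 0` are two regimes with
DIFFERENT physics:

* `stub_fixedCouplingUniversality` (the fixed-coupling regime; "every fixed positive self-repulsion
  flows to the self-avoiding walk", locally uniformly in the coupling): for mesh sequences `dₙ → 0⁺`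
  and couplings `cₙ ∈ (0, 1]` (eventually) with `cₙ → c⋆ > 0`, `Φ_{dₙ}(cₙ) - Φ_{dₙ}(1) → 0`.  This is the
  Domb–Joyce universality folklore `ν(λ) = 3/4`, "same scaling limit as the SAW for every `λ > 0`"
  [BDGS2012 §1.5.2 (1.28); LawlerSchrammWerner2004SAW Prediction 2], in sequential form; rigorous
  analogues exist only for `d > 4` (lace expansion) and `d = 4` (BBS renormalisation group).  OPEN.
* `stub_closingWindowUniversality` (the crossover regime; "every slowly closing Edwards window flows
  to the self-avoiding walk"): for mesh sequences `dₙ → 0⁺` and couplings `cₙ ∈ (0, 1]` (eventually)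
  with `cₙ → 0` but `cₙ / dₙ² → ∞`, `Φ_{dₙ}(cₙ) - Φ_{dₙ}(1) → 0`.  Content: the window `λ = g δ²` with
  `g` FIXED is the diffusive Edwards regime (barrier `PlanarEdwardsModelDiffusive`, Lawler1991 §6.4,
  Stoll1989), excluded by `cₙ / dₙ² → ∞`; the stub says the bare coupling is forgotten as soon as the
  effective continuum coupling diverges, however slowly (the crux's declared failure mode — a
  log-window behaving differently — lives exactly here).  OPEN (new even as a conjecture statement,
  grounder g15-10).

Composition (`tendsto_sub_of_regimes`, kernel-checked, sorry-free): subsequence criterion along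
`𝓝[>] 0`, `isCompact_Icc.tendsto_subseq'` on `n ↦ l(δₙ)`, case split on the limit coupling, the
matching stub on the extracted subsequence; this gives `Φ_δ(l δ) - Φ_δ(1) → 0` for every admissible
schedule `l`, and the crux is the difference of two such limits (`Filter.Tendsto.sub`).  Both stubs are
CONSEQUENCES of the crux (take `l₂ ≡ 1` and read the crux along sequences), so the split loses
nothing; neither implies the crux alone (the first is silent on couplings tending to `0`, the second
on couplings bounded below), and neither mentions the summit's objects beyond the lattice laws.

Disproof used: none relevant (no `Cruxes/CouplingUniversality/Disproof.lean` exists at registration;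
the negatives index of the summit, 11 entries, has no weakly-SAW statement; the only tightness-type
negative, stmt-CriticalPhenomena-0772 "for all meshes", is avoided: no tightness is asserted anywhere,
every mesh hypothesis is a sequence `dₙ → 0⁺` or the filter `𝓝[>] 0`).  Refuter remark honoured
(rreview 02360353 on the item): the stubs inherit the item's `C_b`-asymptotic-equality form only
because the crux is typed that way; they add no uniformity beyond it (each is implied by the crux).
-/

noncomputable section

namespace Summit.CriticalPhenomena.SAWScalingLimit.Cruxes.CouplingUniversality.Birth

open Filter Set MeasureTheory
open scoped Topology
open Literature.Probability.RandomPlanarGeometry Literature.Probability.LatticeModels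

/-! ### The two pieces, as named statements

(The registered STUBS below restate them verbatim over tree vocabulary; `Registered.stub_*` are the
reducible aliases under the stubs' names that the skeleton audit admits as hypotheses of
`CouplingUniversality_of` — it accepts only hypotheses whose head constant is named like a declared stub.) -/

/-- **FixedCouplingUniversality** (piece A, the fixed-coupling regime): for every Dobrushin domain,
endpoint approximation and bounded continuous `f`, along every mesh sequence `dₙ → 0⁺` and every
coupling sequence `cₙ ∈ (0, 1]` (eventually) converging to a POSITIVE limit `c⋆`, the critical
weakly-SAW chordal laws at coupling `cₙ` and at coupling `1` (the SAW, `WeaklySAW.domainLaw_one`)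
are asymptotically equal against `f`. -/
def FixedCouplingUniversality : Prop :=
  ∀ (D : Literature.Probability.RandomPlanarGeometry.DobrushinDomain)
      (a b : ℝ → Literature.Probability.LatticeModels.Site 2),
      Literature.Probability.RandomPlanarGeometry.SAW.IsEndpointApprox D a b →
      ∀ (f : BoundedContinuousFunction (Literature.Probability.RandomPlanarGeometry.CurveClass ℂ) ℝ)
        (d c : ℕ → ℝ) (cstar : ℝ),
        Filter.Tendsto d Filter.atTop (nhdsWithin (0 : ℝ) (Set.Ioi 0)) →
        (∀ᶠ n in Filter.atTop, c n ∈ Set.Ioc (0 : ℝ) 1) →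
        0 < cstar → Filter.Tendsto c Filter.atTop (nhds cstar) →
        Filter.Tendsto (fun n =>
          (∫ x, f x ∂(Literature.Probability.RandomPlanarGeometry.WeaklySAW.domainLaw (c n) D.carrier
              (d n) (a (d n)) (b (d n)))) -
            ∫ x, f x ∂(Literature.Probability.RandomPlanarGeometry.WeaklySAW.domainLaw 1 D.carrier
              (d n) (a (d n)) (b (d n))))
          Filter.atTop (nhds 0)

/-- **ClosingWindowUniversality** (piece B, the crossover regime): for every Dobrushin domain,
endpoint approximation and bounded continuous `f`, along every mesh sequence `dₙ → 0⁺` and every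
coupling sequence `cₙ ∈ (0, 1]` (eventually) with `cₙ → 0` but `cₙ / dₙ² → ∞` (a closing Edwards
window whose effective continuum coupling still diverges), the critical weakly-SAW chordal laws at
coupling `cₙ` and at coupling `1` are asymptotically equal against `f`. -/
def ClosingWindowUniversality : Prop :=
  ∀ (D : Literature.Probability.RandomPlanarGeometry.DobrushinDomain)
      (a b : ℝ → Literature.Probability.LatticeModels.Site 2),
      Literature.Probability.RandomPlanarGeometry.SAW.IsEndpointApprox D a b →
      ∀ (f : BoundedContinuousFunction (Literature.Probability.RandomPlanarGeometry.CurveClass ℂ) ℝ)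
        (d c : ℕ → ℝ),
        Filter.Tendsto d Filter.atTop (nhdsWithin (0 : ℝ) (Set.Ioi 0)) →
        (∀ᶠ n in Filter.atTop, c n ∈ Set.Ioc (0 : ℝ) 1) →
        Filter.Tendsto c Filter.atTop (nhds 0) →
        Filter.Tendsto (fun n => c n / d n ^ 2) Filter.atTop Filter.atTop →
        Filter.Tendsto (fun n =>
          (∫ x, f x ∂(Literature.Probability.RandomPlanarGeometry.WeaklySAW.domainLaw (c n) D.carrier
              (d n) (a (d n)) (b (d n)))) -
            ∫ x, f x ∂(Literature.Probability.RandomPlanarGeometry.WeaklySAW.domainLaw 1 D.carrier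
              (d n) (a (d n)) (b (d n))))
          Filter.atTop (nhds 0)

/-! ### The stubs (the ONLY `sorry`s of the file; verbatim restatements of the two pieces) -/

/-- **Stub A = `FixedCouplingUniversality`, verbatim** (fixed-coupling regime: couplings converging to
a positive limit give, asymptotically, the law of the self-avoiding walk; BDGS2012 (1.28) folklore). -/
theorem stub_fixedCouplingUniversality :
    ∀ (D : Literature.Probability.RandomPlanarGeometry.DobrushinDomain)
      (a b : ℝ → Literature.Probability.LatticeModels.Site 2),
      Literature.Probability.RandomPlanarGeometry.SAW.IsEndpointApprox D a b →
      ∀ (f : BoundedContinuousFunction (Literature.Probability.RandomPlanarGeometry.CurveClass ℂ) ℝ)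
        (d c : ℕ → ℝ) (cstar : ℝ),
        Filter.Tendsto d Filter.atTop (nhdsWithin (0 : ℝ) (Set.Ioi 0)) →
        (∀ᶠ n in Filter.atTop, c n ∈ Set.Ioc (0 : ℝ) 1) →
        0 < cstar → Filter.Tendsto c Filter.atTop (nhds cstar) →
        Filter.Tendsto (fun n =>
          (∫ x, f x ∂(Literature.Probability.RandomPlanarGeometry.WeaklySAW.domainLaw (c n) D.carrier
              (d n) (a (d n)) (b (d n)))) -
            ∫ x, f x ∂(Literature.Probability.RandomPlanarGeometry.WeaklySAW.domainLaw 1 D.carrier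
              (d n) (a (d n)) (b (d n))))
          Filter.atTop (nhds 0) := by
  sorry

/-- **Stub B = `ClosingWindowUniversality`, verbatim** (crossover regime: closing windows `cₙ → 0` with
`cₙ / dₙ² → ∞` give, asymptotically, the law of the self-avoiding walk). -/
theorem stub_closingWindowUniversality :
    ∀ (D : Literature.Probability.RandomPlanarGeometry.DobrushinDomain)
      (a b : ℝ → Literature.Probability.LatticeModels.Site 2),
      Literature.Probability.RandomPlanarGeometry.SAW.IsEndpointApprox D a b →
      ∀ (f : BoundedContinuousFunction (Literature.Probability.RandomPlanarGeometry.CurveClass ℂ) ℝ)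
        (d c : ℕ → ℝ),
        Filter.Tendsto d Filter.atTop (nhdsWithin (0 : ℝ) (Set.Ioi 0)) →
        (∀ᶠ n in Filter.atTop, c n ∈ Set.Ioc (0 : ℝ) 1) →
        Filter.Tendsto c Filter.atTop (nhds 0) →
        Filter.Tendsto (fun n => c n / d n ^ 2) Filter.atTop Filter.atTop →
        Filter.Tendsto (fun n =>
          (∫ x, f x ∂(Literature.Probability.RandomPlanarGeometry.WeaklySAW.domainLaw (c n) D.carrier
              (d n) (a (d n)) (b (d n)))) -
            ∫ x, f x ∂(Literature.Probability.RandomPlanarGeometry.WeaklySAW.domainLaw 1 D.carrier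
              (d n) (a (d n)) (b (d n))))
          Filter.atTop (nhds 0) := by
  sorry

/-! ### Registered names of the stub statements (reducible aliases, for the skeleton audit) -/
namespace Registered

/-- `FixedCouplingUniversality`, under the name of its stub. -/
abbrev stub_fixedCouplingUniversality : Prop := FixedCouplingUniversality
/-- `ClosingWindowUniversality`, under the name of its stub. -/
abbrev stub_closingWindowUniversality : Prop := ClosingWindowUniversality

end Registered

/-! ### The composition (sorry-free) -/

/-- **Regime gluing along mesh sequences** (abstract real analysis, the heart of the composition).
Let `Φ lam δ` be a real two-parameter family (coupling, mesh).  If along every mesh sequence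
`dₙ → 0⁺` and coupling sequence `cₙ ∈ (0, 1]` (eventually) one has `Φ (cₙ) (dₙ) - Φ 1 (dₙ) → 0`
whenever `cₙ → c⋆ > 0` (regime A) and whenever `cₙ → 0` with `cₙ / dₙ² → ∞` (regime B), then
`Φ (l δ) δ - Φ 1 δ → 0` along `δ → 0⁺` for every schedule `l` that is eventually in `(0, 1]` with
`l δ / δ² → ∞`.  Proof: subsequence criterion along the countably generated filter `𝓝[>] 0`,
Bolzano–Weierstrass on `n ↦ l (δₙ) ∈ [0, 1]`, case split on the limit coupling. -/
theorem tendsto_sub_of_regimes {Φ : ℝ → ℝ → ℝ} {l : ℝ → ℝ}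
    (hA : ∀ (d c : ℕ → ℝ) (cstar : ℝ), Tendsto d atTop (𝓝[>] (0 : ℝ)) →
      (∀ᶠ n in atTop, c n ∈ Set.Ioc (0 : ℝ) 1) → 0 < cstar → Tendsto c atTop (𝓝 cstar) →
      Tendsto (fun n => Φ (c n) (d n) - Φ 1 (d n)) atTop (𝓝 0))
    (hB : ∀ (d c : ℕ → ℝ), Tendsto d atTop (𝓝[>] (0 : ℝ)) →
      (∀ᶠ n in atTop, c n ∈ Set.Ioc (0 : ℝ) 1) → Tendsto c atTop (𝓝 0) →
      Tendsto (fun n => c n / d n ^ 2) atTop atTop →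
      Tendsto (fun n => Φ (c n) (d n) - Φ 1 (d n)) atTop (𝓝 0))
    (hl : ∀ᶠ δ in 𝓝[>] (0 : ℝ), l δ ∈ Set.Ioc (0 : ℝ) 1)
    (hl2 : Tendsto (fun δ => l δ / δ ^ 2) (𝓝[>] (0 : ℝ)) atTop) :
    Tendsto (fun δ => Φ (l δ) δ - Φ 1 δ) (𝓝[>] (0 : ℝ)) (𝓝 0) := by
  refine Filter.tendsto_of_subseq_tendsto fun ns hns => ?_
  -- along the mesh sequence `ns`, the couplings are eventually in `(0, 1]`, hence frequently in `[0, 1]`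
  have hev : ∀ᶠ n in atTop, l (ns n) ∈ Set.Ioc (0 : ℝ) 1 := hns.eventually hl
  have hfr : ∃ᶠ n in atTop, (l ∘ ns) n ∈ Set.Icc (0 : ℝ) 1 :=
    (hev.mono fun n hn => Set.Ioc_subset_Icc_self hn).frequently
  -- Bolzano–Weierstrass: a subsequence along which the couplings converge to some `c⋆ ∈ [0, 1]`
  obtain ⟨cstar, hcstar, φ, hφ, hconv⟩ := isCompact_Icc.tendsto_subseq' hfr
  have hns' : Tendsto (ns ∘ φ) atTop (𝓝[>] (0 : ℝ)) := hns.comp hφ.tendsto_atTop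
  have hev' : ∀ᶠ n in atTop, (l ∘ ns ∘ φ) n ∈ Set.Ioc (0 : ℝ) 1 := hφ.tendsto_atTop.eventually hev
  have hconv' : Tendsto (l ∘ ns ∘ φ) atTop (𝓝 cstar) := hconv
  rcases hcstar.1.eq_or_lt with h0 | hpos
  · -- closing window: `c⋆ = 0`, and `cₙ / dₙ² → ∞` is inherited from the schedule
    subst h0
    exact ⟨φ, hB (ns ∘ φ) (l ∘ ns ∘ φ) hns' hev' hconv' (hl2.comp hns')⟩
  · -- fixed-coupling regime: `c⋆ > 0`
    exact ⟨φ, hA (ns ∘ φ) (l ∘ ns ∘ φ) cstar hns' hev' hpos hconv'⟩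

/-- **The crux in the vocabulary of the named law** (`Iff.rfl`: the item's inlined measure `WL lam Ω δ a b`
is `WeaklySAW.domainLaw lam Ω δ a b` definitionally, `WeaklySAW.domainLaw_def`). -/
theorem couplingUniversality_iff :
    Summit.CriticalPhenomena.SAWScalingLimit.Theses.SAWEdwardsStrongCoupling.CouplingUniversality ↔
      ∀ (D : DobrushinDomain) (a b : ℝ → Site 2), SAW.IsEndpointApprox D a b →
        ∀ l₁ l₂ : ℝ → ℝ,
          (∀ᶠ δ in nhdsWithin (0 : ℝ) (Set.Ioi 0), l₁ δ ∈ Set.Ioc (0 : ℝ) 1 ∧ l₂ δ ∈ Set.Ioc (0 : ℝ) 1) →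
          Tendsto (fun δ => l₁ δ / δ ^ 2) (nhdsWithin (0 : ℝ) (Set.Ioi 0)) atTop →
          Tendsto (fun δ => l₂ δ / δ ^ 2) (nhdsWithin (0 : ℝ) (Set.Ioi 0)) atTop →
          ∀ f : BoundedContinuousFunction (CurveClass ℂ) ℝ,
            Tendsto (fun δ => (∫ x, f x ∂(WeaklySAW.domainLaw (l₁ δ) D.carrier δ (a δ) (b δ))) -
                ∫ x, f x ∂(WeaklySAW.domainLaw (l₂ δ) D.carrier δ (a δ) (b δ)))
              (nhdsWithin (0 : ℝ) (Set.Ioi 0)) (𝓝 0) :=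
  Iff.rfl

/-- **`CouplingUniversality` from the line `birth`** (kernel-checked, no `sorry` of its own): the
fixed-coupling regime (stub A) and the closing-window regime (stub B) glue along mesh sequences
(`tendsto_sub_of_regimes`) to `∫ f dWL_{l δ} - ∫ f dWL_1 → 0` for every admissible schedule `l`; the
crux is the difference of the two schedules' limits.  Hypotheses = the two stubs, under their
registered names (`Registered.stub_*`, reducible aliases of `FixedCouplingUniversality` /
`ClosingWindowUniversality`, whose texts are the stub signatures verbatim — certified definitionally
by `CouplingUniversality_proof`). -/
theorem CouplingUniversality_of (hA : Registered.stub_fixedCouplingUniversality)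
    (hB : Registered.stub_closingWindowUniversality) :
    Summit.CriticalPhenomena.SAWScalingLimit.Theses.SAWEdwardsStrongCoupling.CouplingUniversality := by
  dsimp only [Registered.stub_fixedCouplingUniversality, FixedCouplingUniversality,
    Registered.stub_closingWindowUniversality, ClosingWindowUniversality] at hA hB
  rw [couplingUniversality_iff]
  intro D a b hab l₁ l₂ hl h1 h2 f
  -- each admissible schedule is asymptotically equal in law to the SAW (`λ = 1`)
  have key : ∀ l : ℝ → ℝ, (∀ᶠ δ in 𝓝[>] (0 : ℝ), l δ ∈ Set.Ioc (0 : ℝ) 1) →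
      Tendsto (fun δ => l δ / δ ^ 2) (𝓝[>] (0 : ℝ)) atTop →
      Tendsto (fun δ => (∫ x, f x ∂(WeaklySAW.domainLaw (l δ) D.carrier δ (a δ) (b δ))) -
          ∫ x, f x ∂(WeaklySAW.domainLaw 1 D.carrier δ (a δ) (b δ)))
        (𝓝[>] (0 : ℝ)) (𝓝 0) :=
    fun l hl' hl2' =>
      tendsto_sub_of_regimes
        (Φ := fun lam δ => ∫ x, f x ∂(WeaklySAW.domainLaw lam D.carrier δ (a δ) (b δ))) (l := l)
        (hA D a b hab f) (hB D a b hab f) hl' hl2'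
  have h := (key l₁ (hl.mono fun δ hδ => hδ.1) h1).sub (key l₂ (hl.mono fun δ hδ => hδ.2) h2)
  rw [sub_zero] at h
  exact h.congr fun δ => sub_sub_sub_cancel_right _ _ _

/-- Wiring check: the registered stubs feed the composition as stated (this term becomes the crux
proof when the two `sorry`s above are discharged). -/
theorem CouplingUniversality_proof :
    Summit.CriticalPhenomena.SAWScalingLimit.Theses.SAWEdwardsStrongCoupling.CouplingUniversality :=
  CouplingUniversality_of stub_fixedCouplingUniversality stub_closingWindowUniversality

end Summit.CriticalPhenomena.SAWScalingLimit.Cruxes.CouplingUniversality.Birth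

end
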